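import Summits.QuantumFields.YangMills.Theorems.VirialFluxGapPatchingBudget
import Summits.QuantumFields.YangMills.Theorems.VirialFluxGapFixFrameCount
import HarnessLib

/-!
# Route `VirialFluxGap` (YangMills): ASSEMBLY OF THE PATCHED EULER FIELD ON `X_fix`, PART II — the POLYNOMIAL SCALE
# `s = (A·L^a)⁻¹` and the deficit window `t₀ = s²⁰`: below the central window, below the generic window, cross-term rate `≤ 1/16`

Toward the deciding crux `VirialFluxGap.PeriodicSoftness` (item stmt-QuantumFields-24141).  The assembly (Part IV,
`…AssemblyOfCentralField`) runs at `ε = (400L⁴)⁻¹`, `ρ′ = ρ/√2`, `λ⋆ = ερ′²/(3·1032960L⁸)`, `K = C₃L⁴` and the deficit window `t₀ = s²⁰` with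
`s = (A·L^a)⁻¹`, where `A ≥ 2K_C², 400, 1032960·10⁴, (C₃+1)², 21⁵, Dψ+1, 2C₂+2` and `a ≥ 2q_C, 20` dominate the atomic constants of the central
package (`ρ, t_C ≥ (K_C L^{q_C})⁻¹`, `N ≤ K_C L^{q_C}`) and of the three absolute constants `C₃` (third derivatives), `C₂` (gradient–energy), `Dψ`
(`|ψ′|`).  This file does the real arithmetic ONCE:

* `card_le_pow`, `mul_three_le_one` (letters);
* ★★ `scale_package`: `0 < t₀`, `t₀ ≤ t_C`, `t₀ ≤ t_G` (the threshold of ✓`fix_generic_*_window` at `ρ′, ε, K`), the CROSS-TERM RATE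
  `4(Dψ/ρ²)(A_G + N)√t₀ ≤ 1/16` with `A_G = √(#ι·2C₂L⁴/(λ⋆/2)²)·√(4#ι)` (✓`cross_rate_le`), and `(2A²⁰L^{20a})⁻¹ = t₀/2` (✓`half_window_eq`).

HONEST LABEL: elementary real arithmetic; no field is assembled here; ⟨24141⟩, ⟨22884⟩ remain OPEN; the Yang–Mills mass gap is NOT proved; no summit
is proved by a line.  THEOREMS ONLY (0 `def`, 0 `sorry`), standard axioms.  Explicit-unit seat `ym-line-fcl-p3` g41 (cell ym-idea-1, free hands),
`--supports stmt-QuantumFields-24141`.  References: [folklore].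
-/

set_option autoImplicit false

noncomputable section

open scoped BigOperators
open Literature.MathematicalPhysics.QuantumFieldTheory hiding SU2
open Literature.MathematicalPhysics.QuantumLattice

namespace Summit.QuantumFields.YangMills.Theorems.VirialFluxGap.PatchingBudget

open Summit.QuantumFields.YangMills.Theorems.FemtoTransferGap
open Summit.QuantumFields.YangMills.Theorems.VirialFluxGap.FixFrame

variable {L : ℕ} [NeZero L]

/-- Letter: `18L⁴ + 3 ≤ 21L⁴` and `(18L⁴+3)⁵ ≤ 21⁵·L²⁰` for `L ≥ 1`. [folklore] -/
theorem card_le_pow {Lr : ℝ} (hL : 1 ≤ Lr) : 18 * Lr ^ 4 + 3 ≤ 21 * Lr ^ 4 ∧ (18 * Lr ^ 4 + 3) ^ 5 ≤ 21 ^ 5 * Lr ^ 20 := by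
  have h4 : 1 ≤ Lr ^ 4 := one_le_pow₀ hL
  have h1 : 18 * Lr ^ 4 + 3 ≤ 21 * Lr ^ 4 := by linarith
  refine ⟨h1, ?_⟩
  have h0 : 0 ≤ 18 * Lr ^ 4 + 3 := by positivity
  calc (18 * Lr ^ 4 + 3) ^ 5 ≤ (21 * Lr ^ 4) ^ 5 := pow_le_pow_left₀ h0 h1 5
    _ = 21 ^ 5 * Lr ^ 20 := by ring

omit [NeZero L] in
/-- Letter: a product of three numbers `≤ 1`, the last two non-negative, is `≤ 1`. [folklore] -/
theorem mul_three_le_one {a b c : ℝ} (ha1 : a ≤ 1) (hb : 0 ≤ b) (hb1 : b ≤ 1) (hc : 0 ≤ c) (hc1 : c ≤ 1) : a * b * c ≤ 1 :=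
  mul_le_one₀ (mul_le_one₀ ha1 hb hb1) hc hc1

/-- ★★ **THE SCALE PACKAGE.**  With `s = (A·L^a)⁻¹` and `t₀ = s²⁰`: `0 < t₀`, `t₀ ≤ t_C`, `t₀ ≤ t_G(ρ′, ε, C₃L⁴)` (the window of
✓`fix_generic_*_window`, `ρ′ = ρ/√2`, `ε = (400L⁴)⁻¹`), the cross-term rate `4(Dψ/ρ²)(A_G + N)√t₀ ≤ 1/16` with
`A_G = √(#ι·2C₂L⁴/(λ⋆/2)²)·√(4#ι)`, and the window identity `(2A²⁰L^{20a})⁻¹ = t₀/2`. [folklore] -/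
theorem scale_package {K_C : ℝ} (hK_C : 1 ≤ K_C) {q_C : ℕ} {A : ℝ} {a : ℕ} {C₃ C₂ Dψ ρ t_C N : ℝ}
    (hC₃0 : 0 ≤ C₃) (hC₂0 : 0 ≤ C₂) (hDψ0 : 0 ≤ Dψ)
    (hA1 : 2 * K_C ^ 2 ≤ A) (hA2 : 400 ≤ A) (hA3 : 1032960 * 10000 ≤ A) (hA4 : (C₃ + 1) ^ 2 ≤ A) (hA5 : (21 : ℝ) ^ 5 ≤ A)
    (hA7 : Dψ + 1 ≤ A) (hA8 : 2 * C₂ + 2 ≤ A) (ha1 : 2 * q_C ≤ a) (ha2 : 20 ≤ a)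
    (hρlo : (K_C * (L : ℝ) ^ q_C)⁻¹ ≤ ρ) (hρhi : ρ ≤ 1 / 2) (htC : (K_C * (L : ℝ) ^ q_C)⁻¹ ≤ t_C) (hN0 : 0 ≤ N) (hN : N ≤ K_C * (L : ℝ) ^ q_C) :
    0 < ((A * (L : ℝ) ^ a)⁻¹) ^ 20 ∧
    ((A * (L : ℝ) ^ a)⁻¹) ^ 20 ≤ t_C ∧
    ((A * (L : ℝ) ^ a)⁻¹) ^ 20 ≤ (ρ / Real.sqrt 2) ^ 2 * ((400 * (L : ℝ) ^ 4)⁻¹) ^ 3 * ((ρ / Real.sqrt 2) ^ 2 / (1032960 * (L : ℝ) ^ 8)) ^ 2 /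
          (1032960 * 10000 * (L : ℝ) ^ 8 * (C₃ * (L : ℝ) ^ 4 + 1) ^ 2 * (Fintype.card (FixVar L × Fin 3) : ℝ) ^ 5) ∧
    4 * (Dψ / ρ ^ 2) * (Real.sqrt ((Fintype.card (FixVar L × Fin 3) : ℝ) * (2 * (C₂ * (L : ℝ) ^ 4)) /
          (((400 * (L : ℝ) ^ 4)⁻¹ * ((ρ / Real.sqrt 2) ^ 2 / (1032960 * (L : ℝ) ^ 8)) / 3) / 2) ^ 2) *
        Real.sqrt (4 * (Fintype.card (FixVar L × Fin 3) : ℝ)) + N) * Real.sqrt (((A * (L : ℝ) ^ a)⁻¹) ^ 20) ≤ 1 / 16 ∧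
    (2 * A ^ 20 * (L : ℝ) ^ (((20 * a : ℕ) : ℝ)))⁻¹ = ((A * (L : ℝ) ^ a)⁻¹) ^ 20 / 2 := by
  /- reals -/
  have hL1 : (1 : ℝ) ≤ L := by exact_mod_cast NeZero.one_le
  have hL0 : (0 : ℝ) < L := by positivity
  have hA0 : 0 < A := by linarith
  have hA1' : 1 ≤ A := by linarith
  have hKC0 : 0 < K_C := by linarith
  have hKA : K_C ≤ A := by nlinarith only [hK_C, hA1]
  have hPpos : 0 < K_C * (L : ℝ) ^ q_C := by positivity
  have hρ0 : 0 < ρ := lt_of_lt_of_le (by positivity) hρlo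
  have hρ1 : ρ ≤ 1 := by linarith
  -- the scale
  set s : ℝ := (A * (L : ℝ) ^ a)⁻¹ with hs
  have hs0 : 0 < s := by rw [hs]; positivity
  have hsinv : s⁻¹ = A * (L : ℝ) ^ a := by rw [hs, inv_inv]
  have hsle : ∀ {A' : ℝ} {a' : ℕ}, 0 < A' → A' ≤ A → a' ≤ a → s ≤ (A' * (L : ℝ) ^ a')⁻¹ :=
    fun hA' hAA haa => inv_poly_le_inv_poly hA' hAA haa hL1
  have hles : ∀ {X A' : ℝ} {a' : ℕ}, X ≤ A' * (L : ℝ) ^ a' → 0 ≤ A' → A' ≤ A → a' ≤ a → X ≤ s⁻¹ := by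
    intro X A' a' hX hA'0 hAA haa
    rw [hsinv]
    exact hX.trans (mul_le_mul hAA (pow_le_pow_right₀ hL1 haa) (by positivity) hA0.le)
  have at320 : s ≤ 1 / 320 := by
    have h := hsle (A' := 320) (a' := 0) (by norm_num) (by linarith) (Nat.zero_le _)
    simpa using h
  have hs1 : s ≤ 1 := by linarith
  have at3 : 3 * s ≤ 1 := by linarith
  have atP : s ≤ (K_C * (L : ℝ) ^ q_C)⁻¹ := hsle hKC0 hKA (by omega)
  have atρ2 : s ≤ ρ ^ 2 / 2 := by
    have h1 : s ≤ (2 * K_C ^ 2 * (L : ℝ) ^ (2 * q_C))⁻¹ := hsle (by positivity) hA1 ha1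
    have h2 : (2 * K_C ^ 2 * (L : ℝ) ^ (2 * q_C))⁻¹ = ((K_C * (L : ℝ) ^ q_C)⁻¹) ^ 2 / 2 := by
      rw [pow_mul]; field_simp; ring
    have h3 : ((K_C * (L : ℝ) ^ q_C)⁻¹) ^ 2 ≤ ρ ^ 2 := pow_le_pow_left₀ (by positivity) hρlo 2
    rw [h2] at h1
    linarith
  have atρ : s ≤ ρ ^ 2 := atρ2.trans (by linarith [sq_nonneg ρ])
  have atε : s ≤ (400 * (L : ℝ) ^ 4)⁻¹ := hsle (by norm_num) hA2 (by omega)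
  have at8 : s ≤ (1032960 * (L : ℝ) ^ 8)⁻¹ := hsle (by norm_num) (by linarith) (by omega)
  have at8' : (1032960 * (L : ℝ) ^ 8) * s ≤ 1 := by
    rw [← le_div_iff₀' (by positivity), one_div]; exact at8
  have aty1 : (1032960 * 10000 * (L : ℝ) ^ 8) * s ≤ 1 := by
    rw [← le_div_iff₀' (by positivity), one_div]; exact hsle (by norm_num) hA3 (by omega)
  have aty2 : (C₃ * (L : ℝ) ^ 4 + 1) ^ 2 * s ≤ 1 := by
    have h1 : C₃ * (L : ℝ) ^ 4 + 1 ≤ (C₃ + 1) * (L : ℝ) ^ 4 := by nlinarith only [one_le_pow₀ (n := 4) hL1, hC₃0]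
    have h2 : (C₃ * (L : ℝ) ^ 4 + 1) ^ 2 ≤ (C₃ + 1) ^ 2 * (L : ℝ) ^ 8 := by
      calc (C₃ * (L : ℝ) ^ 4 + 1) ^ 2 ≤ ((C₃ + 1) * (L : ℝ) ^ 4) ^ 2 := pow_le_pow_left₀ (by positivity) h1 2
        _ = (C₃ + 1) ^ 2 * (L : ℝ) ^ 8 := by ring
    have h3 : s ≤ ((C₃ + 1) ^ 2 * (L : ℝ) ^ 8)⁻¹ := hsle (by positivity) hA4 (by omega)
    rw [le_inv_comm₀ hs0 (by positivity)] at h3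
    calc (C₃ * (L : ℝ) ^ 4 + 1) ^ 2 * s ≤ (C₃ + 1) ^ 2 * (L : ℝ) ^ 8 * s := mul_le_mul_of_nonneg_right h2 hs0.le
      _ ≤ s⁻¹ * s := mul_le_mul_of_nonneg_right h3 hs0.le
      _ = 1 := inv_mul_cancel₀ hs0.ne'
  have hcard : (Fintype.card (FixVar L × Fin 3) : ℝ) = 18 * (L : ℝ) ^ 4 + 3 := card_fixVar_mul_three_real
  obtain ⟨hc21, hc5⟩ := card_le_pow hL1
  have aty3 : (Fintype.card (FixVar L × Fin 3) : ℝ) ^ 5 * s ≤ 1 := by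
    rw [hcard]
    have h3 : s ≤ ((21 : ℝ) ^ 5 * (L : ℝ) ^ 20)⁻¹ := hsle (by positivity) hA5 ha2
    rw [le_inv_comm₀ hs0 (by positivity)] at h3
    calc (18 * (L : ℝ) ^ 4 + 3) ^ 5 * s ≤ (21 : ℝ) ^ 5 * (L : ℝ) ^ 20 * s := mul_le_mul_of_nonneg_right hc5 hs0.le
      _ ≤ s⁻¹ * s := mul_le_mul_of_nonneg_right h3 hs0.le
      _ = 1 := inv_mul_cancel₀ hs0.ne'
  have attC : s ≤ t_C := atP.trans htC
  have atN : N ≤ s⁻¹ := hles hN hKC0.le hKA (by omega)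
  have atD : Dψ ≤ s⁻¹ := hles (A' := Dψ + 1) (a' := 0) (by rw [pow_zero, mul_one]; linarith) (by linarith) hA7 (Nat.zero_le _)
  have atc : (Fintype.card (FixVar L × Fin 3) : ℝ) ≤ s⁻¹ := by
    rw [hcard]; exact hles hc21 (by norm_num) (le_trans (by norm_num) hA5) (by omega)
  have atL4 : (L : ℝ) ^ 4 ≤ s⁻¹ := hles (A' := 1) (a' := 4) (by rw [one_mul]) zero_le_one hA1' (by omega)
  have atC2 : 2 * C₂ ≤ s⁻¹ := hles (A' := 2 * C₂ + 2) (a' := 0) (by rw [pow_zero, mul_one]; linarith) (by linarith) hA8 (Nat.zero_le _)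
  /- parameters -/
  set ρ' : ℝ := ρ / Real.sqrt 2 with hρ'def
  have hρ'sq : ρ' ^ 2 = ρ ^ 2 / 2 := by
    rw [hρ'def, div_pow, Real.sq_sqrt (by norm_num)]
  set ε : ℝ := (400 * (L : ℝ) ^ 4)⁻¹ with hεdef
  have hε0 : 0 < ε := by rw [hεdef]; positivity
  have hκ : s ^ 2 ≤ ρ' ^ 2 / (1032960 * (L : ℝ) ^ 8) :=
    pow_add_le_div (m := 1) (n := 1) hs0.le (by rw [pow_one, hρ'sq]; exact atρ2) (by positivity) (by simpa using at8')
  have hlam : s ^ 4 ≤ ε * (ρ' ^ 2 / (1032960 * (L : ℝ) ^ 8)) / 3 :=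
    pow_add_le_div (m := 3) (n := 1) hs0.le (pow_add_le_mul (m := 1) (n := 2) hs0.le (by rw [pow_one]; exact atε) hκ) (by norm_num)
      (by simpa [mul_comm] using at3)
  have hlam0 : 0 < ε * (ρ' ^ 2 / (1032960 * (L : ℝ) ^ 8)) / 3 := by positivity
  /- t_G ≥ s¹¹ -/
  have htG : s ^ 11 ≤ ρ' ^ 2 * ε ^ 3 * (ρ' ^ 2 / (1032960 * (L : ℝ) ^ 8)) ^ 2 /
      (1032960 * 10000 * (L : ℝ) ^ 8 * (C₃ * (L : ℝ) ^ 4 + 1) ^ 2 * (Fintype.card (FixVar L × Fin 3) : ℝ) ^ 5) := by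
    have hnum : s ^ 8 ≤ ρ' ^ 2 * ε ^ 3 * (ρ' ^ 2 / (1032960 * (L : ℝ) ^ 8)) ^ 2 := by
      have h1 : s ^ 1 ≤ ρ' ^ 2 := by rw [pow_one, hρ'sq]; exact atρ2
      have h2 : s ^ 3 ≤ ε ^ 3 := pow_le_pow_left₀ hs0.le atε 3
      have h3 : s ^ 4 ≤ (ρ' ^ 2 / (1032960 * (L : ℝ) ^ 8)) ^ 2 := by
        rw [show s ^ 4 = (s ^ 2) ^ 2 by ring]; exact pow_le_pow_left₀ (by positivity) hκ 2
      exact pow_add_le_mul (m := 4) (n := 4) hs0.le (pow_add_le_mul (m := 1) (n := 3) hs0.le h1 h2) h3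
    refine pow_add_le_div (m := 8) (n := 3) hs0.le hnum (by positivity) ?_
    have e : 1032960 * 10000 * (L : ℝ) ^ 8 * (C₃ * (L : ℝ) ^ 4 + 1) ^ 2 * (Fintype.card (FixVar L × Fin 3) : ℝ) ^ 5 * s ^ 3 =
        ((1032960 * 10000 * (L : ℝ) ^ 8) * s) * (((C₃ * (L : ℝ) ^ 4 + 1) ^ 2) * s) * (((Fintype.card (FixVar L × Fin 3) : ℝ) ^ 5) * s) := by ring
    rw [e]
    exact mul_three_le_one aty1 (by positivity) aty2 (by positivity) aty3
  /- the cross-term rate -/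
  set AG : ℝ := Real.sqrt ((Fintype.card (FixVar L × Fin 3) : ℝ) * (2 * (C₂ * (L : ℝ) ^ 4)) /
      ((ε * (ρ' ^ 2 / (1032960 * (L : ℝ) ^ 8)) / 3) / 2) ^ 2) * Real.sqrt (4 * (Fintype.card (FixVar L × Fin 3) : ℝ)) with hAGdef
  have hAG0 : 0 ≤ AG := by rw [hAGdef]; positivity
  have hAG : AG ≤ 4 * (s ^ 7)⁻¹ := by
    have hlam8 : s ^ 8 ≤ (ε * (ρ' ^ 2 / (1032960 * (L : ℝ) ^ 8)) / 3) ^ 2 := by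
      rw [show s ^ 8 = (s ^ 4) ^ 2 by ring]; exact pow_le_pow_left₀ (by positivity) hlam 2
    have hcs : (Fintype.card (FixVar L × Fin 3) : ℝ) * s ≤ 1 := by
      have := mul_le_mul_of_nonneg_right atc hs0.le; rwa [inv_mul_cancel₀ hs0.ne'] at this
    have hC2s : 2 * C₂ * s ≤ 1 := by
      have := mul_le_mul_of_nonneg_right atC2 hs0.le; rwa [inv_mul_cancel₀ hs0.ne'] at this
    have hL4s : (L : ℝ) ^ 4 * s ≤ 1 := by
      have := mul_le_mul_of_nonneg_right atL4 hs0.le; rwa [inv_mul_cancel₀ hs0.ne'] at this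
    have hsq : AG ^ 2 = ((Fintype.card (FixVar L × Fin 3) : ℝ) * (2 * (C₂ * (L : ℝ) ^ 4)) /
        ((ε * (ρ' ^ 2 / (1032960 * (L : ℝ) ^ 8)) / 3) / 2) ^ 2) * (4 * (Fintype.card (FixVar L × Fin 3) : ℝ)) := by
      rw [hAGdef, mul_pow, Real.sq_sqrt (by positivity), Real.sq_sqrt (by positivity)]
    have hkey : AG ^ 2 * s ^ 14 ≤ 16 := by
      rw [hsq]
      have hden : 0 < ((ε * (ρ' ^ 2 / (1032960 * (L : ℝ) ^ 8)) / 3) / 2) ^ 2 := by positivity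
      rw [div_mul_eq_mul_div, div_mul_eq_mul_div, div_le_iff₀ hden]
      have e : (Fintype.card (FixVar L × Fin 3) : ℝ) * (2 * (C₂ * (L : ℝ) ^ 4)) * (4 * (Fintype.card (FixVar L × Fin 3) : ℝ)) * s ^ 14 =
          4 * ((((Fintype.card (FixVar L × Fin 3) : ℝ) * s) * ((Fintype.card (FixVar L × Fin 3) : ℝ) * s)) * ((2 * C₂ * s) * ((L : ℝ) ^ 4 * s))) * s ^ 10 := by
        ring
      have hp1 : ((Fintype.card (FixVar L × Fin 3) : ℝ) * s) * ((Fintype.card (FixVar L × Fin 3) : ℝ) * s) ≤ 1 :=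
        mul_le_one₀ hcs (by positivity) hcs
      have hp2 : (2 * C₂ * s) * ((L : ℝ) ^ 4 * s) ≤ 1 := mul_le_one₀ hC2s (by positivity) hL4s
      have hp : (((Fintype.card (FixVar L × Fin 3) : ℝ) * s) * ((Fintype.card (FixVar L × Fin 3) : ℝ) * s)) * ((2 * C₂ * s) * ((L : ℝ) ^ 4 * s)) ≤ 1 :=
        mul_le_one₀ hp1 (by positivity) hp2
      have hs10 : s ^ 10 ≤ s ^ 8 := pow_le_pow_of_le_one hs0.le hs1 (by norm_num)
      have hs10' : 0 ≤ s ^ 10 := by positivity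
      calc (Fintype.card (FixVar L × Fin 3) : ℝ) * (2 * (C₂ * (L : ℝ) ^ 4)) * (4 * (Fintype.card (FixVar L × Fin 3) : ℝ)) * s ^ 14
          = 4 * ((((Fintype.card (FixVar L × Fin 3) : ℝ) * s) * ((Fintype.card (FixVar L × Fin 3) : ℝ) * s)) * ((2 * C₂ * s) * ((L : ℝ) ^ 4 * s))) * s ^ 10 := e
        _ ≤ 4 * 1 * s ^ 10 := mul_le_mul_of_nonneg_right (mul_le_mul_of_nonneg_left hp (by norm_num)) hs10'
        _ ≤ 4 * 1 * s ^ 8 := mul_le_mul_of_nonneg_left hs10 (by norm_num)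
        _ ≤ 4 * (ε * (ρ' ^ 2 / (1032960 * (L : ℝ) ^ 8)) / 3) ^ 2 := by linarith only [hlam8]
        _ = 16 * ((ε * (ρ' ^ 2 / (1032960 * (L : ℝ) ^ 8)) / 3) / 2) ^ 2 := by ring
    have htarget : (4 * (s ^ 7)⁻¹) ^ 2 * s ^ 14 = 16 := by field_simp; ring
    have h0 : 0 ≤ 4 * (s ^ 7)⁻¹ := by positivity
    by_contra hcon
    rw [not_le] at hcon
    have h1 : (4 * (s ^ 7)⁻¹) ^ 2 < AG ^ 2 := by gcongr
    have h2 : (4 * (s ^ 7)⁻¹) ^ 2 * s ^ 14 < AG ^ 2 * s ^ 14 := mul_lt_mul_of_pos_right h1 (by positivity)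
    linarith only [h2, hkey, htarget]
  have hcross : 4 * (Dψ / ρ ^ 2) * (AG + N) * Real.sqrt (s ^ 20) ≤ 1 / 16 :=
    cross_rate_le hs0 at320 hDψ0 atD atρ hAG0 hAG hN0 atN
  /- conclusion -/
  refine ⟨by positivity, (pow_le_of_le_one hs0.le hs1 (by norm_num)).trans attC,
    (pow_le_pow_of_le_one hs0.le hs1 (by norm_num : 11 ≤ 20)).trans htG, hcross, ?_⟩
  rw [hs]; exact half_window_eq hA0 hL0

end Summit.QuantumFields.YangMills.Theorems.VirialFluxGap.PatchingBudget

end
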